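import Mathlib
import HarnessLib
import Summits.HubbardSuperconductivity.HubbardSuperconductivity.Theorems.WeakCouplingBCSDefsKlCertTPrime

/-!
# KL boost twins — typed sketch for the round-7 crux idea «kl-boost-twin-rivals»
(planner hubbard-klscan-idea-1 g7, lens «anomaly»; bears on the certificate half
`WeakCouplingBCS.WcbcsKohnLuttingerB1g` = stmt-HubbardSuperconductivity-0158, HQ1 (i)–(iii)).

MEASURED ANOMALY (floats, pure-python Nyström on the exact `t′ = 0` Lindhard function, M = 256,
converged in M ∈ {192,…,512} and in the s-quadrature): at `t′ = 0` the two σ_d-EVEN rival channel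
bottoms `λ₁(A1g)` (extended s) and `λ₁(B2g)` (d_xy) of the O(U²) Kohn–Luttinger kernel are
(a) TWINS — equal within 6.5 % — and (b) δ-FLAT — both inside `[-0.0167, -0.0152]` — for every
hole doping `δ ∈ [0.075, 0.30]` (μ ∈ [-0.721, -0.127]), while `λ₁(B1g)` falls from `-0.51` to
`-0.09`; the SCAN-TABLE v0.x values of the same two columns (`-0.046 … -0.021`) are 20–70 %
antidiagonal artefact (r2 LAW).  PROPOSED MECHANISM: an approximate SO(1,1) boost symmetry of the
nested two-saddle scaling limit, whose antisymmetrised generator intertwines A1g ↔ B2g and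
B1g ↔ A2g (§1 is the exact algebraic skeleton of that statement; §2 the D₄ bookkeeping; §3 the
float-facing Props with ∃-free but slack thresholds, measured instances in docstrings only).

Honest framing: floats are floats; nothing here asserts a margin at t′ ≠ 0, K₃, U₀, the window or
superconductivity; a KL O(U²) channel statement is not ODLRO.  0 sorry.
-/

set_option linter.dupNamespace false

namespace Summit.HubbardSuperconductivity.HubbardSuperconductivity.Theorems.KlBoostTwins

open Literature.MathematicalPhysics.QuantumLattice

/-! ## §1 The intertwining skeleton (exact linear algebra, proved)

`K` = the channel-blind pairing operator, `B`, `B'` = a boost and its inverse (both commuting with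
`K`), `σ` = a point-group element that conjugates the boost to its inverse (`σ_x` or the rotation
`r`), `τ` = one that commutes with it (`σ_d`).  Then `B - B'` maps a `K`-eigenvector with
`σ`-parity `a` and `τ`-parity `c` to a `K`-eigenvector (same eigenvalue) with `σ`-parity `-a` and
`τ`-parity `c` — i.e. A1g ↔ B2g and B1g ↔ A2g — unless it annihilates it (boost-invariant states). -/

section Intertwiner

variable {V : Type*} [AddCommGroup V] [Module ℝ V]

/-- The antisymmetrised boost preserves `K`-eigenvectors with their eigenvalue. -/
theorem boostDiff_eigen (K B B' : V →ₗ[ℝ] V)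
    (hKB : K ∘ₗ B = B ∘ₗ K) (hKB' : K ∘ₗ B' = B' ∘ₗ K)
    {v : V} {lam : ℝ} (hv : K v = lam • v) :
    K ((B - B') v) = lam • (B - B') v := by
  have h1 : K (B v) = B (K v) := LinearMap.congr_fun hKB v
  have h2 : K (B' v) = B' (K v) := LinearMap.congr_fun hKB' v
  simp only [LinearMap.sub_apply, map_sub, h1, h2, hv, map_smul, smul_sub]

/-- The antisymmetrised boost FLIPS the parity under any symmetry conjugating the boost to its
inverse (`σ_x`, and the rotation `r`): A1g ↔ B2g, B1g ↔ A2g at the level of `(σ_x, r)`-characters. -/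
theorem boostDiff_parity_flip (B B' σ : V →ₗ[ℝ] V)
    (hσB : σ ∘ₗ B = B' ∘ₗ σ) (hσB' : σ ∘ₗ B' = B ∘ₗ σ)
    {v : V} {a : ℝ} (hσv : σ v = a • v) :
    σ ((B - B') v) = (-a) • (B - B') v := by
  have h1 : σ (B v) = B' (σ v) := LinearMap.congr_fun hσB v
  have h2 : σ (B' v) = B (σ v) := LinearMap.congr_fun hσB' v
  simp only [LinearMap.sub_apply, map_sub, h1, h2, hσv, map_smul, neg_smul, smul_sub]
  abel

/-- The antisymmetrised boost KEEPS the parity under any symmetry commuting with the boost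
(`σ_d`): the twin map preserves the σ_d-character, so it pairs the σ_d-even irreps {A1g, B2g}
among themselves and the σ_d-odd irreps {B1g, A2g} among themselves. -/
theorem boostDiff_parity_keep (B B' τ : V →ₗ[ℝ] V)
    (hτB : τ ∘ₗ B = B ∘ₗ τ) (hτB' : τ ∘ₗ B' = B' ∘ₗ τ)
    {v : V} {c : ℝ} (hτv : τ v = c • v) :
    τ ((B - B') v) = c • (B - B') v := by
  have h1 : τ (B v) = B (τ v) := LinearMap.congr_fun hτB v
  have h2 : τ (B' v) = B' (τ v) := LinearMap.congr_fun hτB' v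
  simp only [LinearMap.sub_apply, map_sub, h1, h2, hτv, map_smul, smul_sub]

/-- Boost-invariant eigenvectors are annihilated: the twin map says nothing about them (this is
where the nesting-driven `B1g`/`A2g` LEADING states sit — their bottoms are NOT twins). -/
theorem boostDiff_eq_zero_of_invariant (B B' : V →ₗ[ℝ] V) {v : V}
    (hB : B v = v) (hB' : B' v = v) : (B - B') v = 0 := by
  simp [LinearMap.sub_apply, hB, hB']

/-- Packaged twin statement: exact symmetry ⇒ exact isospectrality of the non-invariant part. -/
theorem twin_eigenpair (K B B' σ τ : V →ₗ[ℝ] V)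
    (hKB : K ∘ₗ B = B ∘ₗ K) (hKB' : K ∘ₗ B' = B' ∘ₗ K)
    (hσB : σ ∘ₗ B = B' ∘ₗ σ) (hσB' : σ ∘ₗ B' = B ∘ₗ σ)
    (hτB : τ ∘ₗ B = B ∘ₗ τ) (hτB' : τ ∘ₗ B' = B' ∘ₗ τ)
    {v : V} {lam a c : ℝ} (hv : K v = lam • v) (hσv : σ v = a • v) (hτv : τ v = c • v) :
    K ((B - B') v) = lam • (B - B') v ∧ σ ((B - B') v) = (-a) • (B - B') v ∧
      τ ((B - B') v) = c • (B - B') v :=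
  ⟨boostDiff_eigen K B B' hKB hKB' hv, boostDiff_parity_flip B B' σ hσB hσB' hσv,
    boostDiff_parity_keep B B' τ hτB hτB' hτv⟩

end Intertwiner

/-! ## §2 D₄ bookkeeping: the twin map on irreps -/

/-- The twin of an irrep under the boost intertwiner: flip the `σ_x`- and `r`-characters, keep the
`σ_d`-character.  `E` is its own twin. -/
def twinOf : D4Irrep → D4Irrep
  | .A1g => .B2g
  | .B2g => .A1g
  | .B1g => .A2g
  | .A2g => .B1g
  | .E => .E

/-- The twin map is an involution (twins come in pairs; `E` is self-twin). -/
theorem twinOf_twinOf (χ : D4Irrep) : twinOf (twinOf χ) = χ := by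
  cases χ <;> rfl

/-- `σ_d`-character (`sr 1` = reflection in a diagonal) is preserved by the twin map. -/
theorem char_twinOf_diag (χ : D4Irrep) :
    (twinOf χ).char (DihedralGroup.sr 1) = χ.char (DihedralGroup.sr 1) := by
  cases χ <;> simp [twinOf, D4Irrep.char, ZMod.val_one_eq_one_mod]

/-- `σ_x`-character (`sr 0` = reflection in the `k₀`-axis) is flipped on the one-dimensional irreps. -/
theorem char_twinOf_axis (χ : D4Irrep) (hχ : χ ≠ .E) :
    (twinOf χ).char (DihedralGroup.sr 0) = -χ.char (DihedralGroup.sr 0) := by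
  cases χ <;> simp_all [twinOf, D4Irrep.char]

/-- `r`-character (rotation by `π/2`) is flipped on the one-dimensional irreps. -/
theorem char_twinOf_rot (χ : D4Irrep) (hχ : χ ≠ .E) :
    (twinOf χ).char (DihedralGroup.r 1) = -χ.char (DihedralGroup.r 1) := by
  cases χ <;> simp_all [twinOf, D4Irrep.char, ZMod.val_one_eq_one_mod]

/-- On one-dimensional irreps `χ(σ_d) = χ(r)·χ(σ_x)`: the σ_d-even irreps are exactly {A1g, B2g},
the σ_d-odd ones {B1g, A2g} (the observed packet / nesting dichotomy of the rival spectra). -/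
theorem char_diag_eq_rot_mul_axis (χ : D4Irrep) (hχ : χ ≠ .E) :
    χ.char (DihedralGroup.sr 1) = χ.char (DihedralGroup.r 1) * χ.char (DihedralGroup.sr 0) := by
  cases χ <;> simp_all [D4Irrep.char, ZMod.val_one_eq_one_mod]

/-! ## §3 Float-facing statements (Props; measured instances in the docstrings only) -/

/-- The `t′ = 0`, `U = 1` channel bottom of the O(U²) Kohn–Luttinger kernel in the irrep `χ` at
chemical potential `μ` (the certificate's `channelInf`; for `A1g` the kernel's bare-`U` term acts on
the constant mode only approximately orthogonally to the packet bottom — slack below covers it). -/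
noncomputable def klBottom0 (χ : D4Irrep) (μ : ℝ) : ℝ := channelInf (squareDispersion 1 0) μ 1 χ

/-- The twin window in chemical potential: `μ(δ)` for hole dopings `δ ∈ [0.075, 0.30]` at `t′ = 0`
(floats: μ(0.075) = -0.12686, μ(0.30) = -0.72097). -/
def twinWindow : Set ℝ := Set.Icc (-(721 / 1000 : ℝ)) (-(127 / 1000 : ℝ))

/-- **K1 (twin rivals).**  On `W` the A1g and B2g bottoms agree to relative precision `η`.
Measured at `t′ = 0` (exact-χ₀ Nyström, M = 256): max relative splitting 0.065 on `twinWindow`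
(at δ = 0.125), 0.10 at δ = 0.05, 0.28 at δ = 0.35, O(1) at δ ≤ 0.02 and at t′ = -0.1. -/
def KlTwinRivals (η : ℝ) (W : Set ℝ) : Prop :=
  ∀ μ ∈ W, |klBottom0 .A1g μ - klBottom0 .B2g μ| ≤ η * |klBottom0 .B2g μ|

/-- **K2 (flat twin floor).**  On `W` both even-rival bottoms lie in the band `[lo, hi]`.
Measured at `t′ = 0`: both in `[-0.0167, -0.0152]` on `twinWindow` (10 cells), i.e. a floor
`λ* = -0.0159 ± 5 %` while `λ₁(B1g)` runs from `-0.51` to `-0.09`. -/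
def KlTwinFloorBand (lo hi : ℝ) (W : Set ℝ) : Prop :=
  ∀ μ ∈ W, klBottom0 .A1g μ ∈ Set.Icc lo hi ∧ klBottom0 .B2g μ ∈ Set.Icc lo hi

/-- The round-7 instance of K1 proposed as an item (slack ×3 over the measured 0.065). -/
def KlTwinRivalsR7 : Prop := KlTwinRivals (1 / 5) twinWindow

/-- The round-7 instance of K2 proposed as an item (band `[-0.019, -0.013]`, slack ≥ 0.002 each
side over the measured `[-0.0167, -0.0152]`, and ≥ 0.001 over the bare-`U` shift of the A1g
bottom seen in idea-2's `λ_A1g(U)` column). -/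
def KlTwinFloorBandR7 : Prop := KlTwinFloorBand (-(19 / 1000)) (-(13 / 1000)) twinWindow

/-- Hole dopings of the twin regime, `δ ∈ [0.075, 0.30]`. -/
def twinDopings : Set ℝ := Set.Icc (3 / 40 : ℝ) (3 / 10)

/-- δ-keyed form of K2 (the certificate is keyed by `δ` through `klMuOfDopingTP 0 δ`). -/
def KlTwinFloorBandDelta (lo hi : ℝ) (D : Set ℝ) : Prop :=
  ∀ δ ∈ D, klBottom0 .A1g (klMuOfDopingTP 0 δ) ∈ Set.Icc lo hi ∧
    klBottom0 .B2g (klMuOfDopingTP 0 δ) ∈ Set.Icc lo hi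

/-- The round-7 δ-keyed instance. -/
def KlTwinFloorBandDeltaR7 : Prop := KlTwinFloorBandDelta (-(19 / 1000)) (-(13 / 1000)) twinDopings

/-- μ-window band ⇒ δ-keyed band, given that `μ(δ)` of the doping set lands in the window
(for `twinDopings`/`twinWindow` this is the monotonicity of `μ(δ)` plus two endpoint values — the
`filling_monotone` machinery of `WeakCouplingBCSKlIsoDensityLevelMotion`, not re-proved here). -/
theorem floorBandDelta_of_floorBand {lo hi : ℝ} {W D : Set ℝ} (h : KlTwinFloorBand lo hi W)
    (hWD : ∀ δ ∈ D, klMuOfDopingTP 0 δ ∈ W) : KlTwinFloorBandDelta lo hi D :=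
  fun δ hδ => h _ (hWD δ hδ)

/-- The B1g margin over the two EVEN rivals (the census quantity the twins collapse to one number). -/
noncomputable def evenMargin (μ : ℝ) : ℝ := min (klBottom0 .A1g μ) (klBottom0 .B2g μ) - klBottom0 .B1g μ

/-- **Census use (HQ1 (i)).**  In the band regime a separation `γ` of `λ₁(B1g)` below the band
floor `lo` is a separation from BOTH even rivals at once — one leaf instead of two per cell, in the
shape `channelInf B1g + γ ≤ channelInf χ` consumed by `ChiralWindowCwThesisUFreeAnchor`. -/
theorem evenRivals_of_floorBand {lo hi : ℝ} {W : Set ℝ} (h : KlTwinFloorBand lo hi W)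
    {μ : ℝ} (hμ : μ ∈ W) {γ : ℝ} (hB : klBottom0 .B1g μ + γ ≤ lo) :
    klBottom0 .B1g μ + γ ≤ klBottom0 .A1g μ ∧ klBottom0 .B1g μ + γ ≤ klBottom0 .B2g μ :=
  ⟨hB.trans (h μ hμ).1.1, hB.trans (h μ hμ).2.1⟩

/-- **Monotonicity use (HQ1 (ii)).**  In the band regime the even margin is monotone along any
pair of window points across which `λ₁(B1g)` rises by at least the band width: δ-monotonicity of
the margin reduces to δ-monotonicity of ONE channel, up to the (measured 0.0015-wide) band. -/
theorem evenMargin_mono_of_floorBand {lo hi : ℝ} {W : Set ℝ} (h : KlTwinFloorBand lo hi W)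
    {μ₁ μ₂ : ℝ} (hμ₁ : μ₁ ∈ W) (hμ₂ : μ₂ ∈ W)
    (hB : klBottom0 .B1g μ₂ + (hi - lo) ≤ klBottom0 .B1g μ₁) :
    evenMargin μ₁ ≤ evenMargin μ₂ := by
  have h1 : min (klBottom0 .A1g μ₁) (klBottom0 .B2g μ₁) ≤ hi :=
    (min_le_left _ _).trans (h μ₁ hμ₁).1.2
  have h2 : lo ≤ min (klBottom0 .A1g μ₂) (klBottom0 .B2g μ₂) :=
    le_min (h μ₂ hμ₂).1.1 (h μ₂ hμ₂).2.1
  unfold evenMargin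
  linarith

/-- **Window-end use (HQ1 (iii), δ-direction at t′ = 0).**  In the band regime, wherever
`λ₁(B1g)` is still below `lo` the even rivals cannot have taken over; the t′ = 0 d-wave window in
δ can only end (against A1g/B2g) after `λ₁(B1g)` has risen into the band. -/
theorem evenMargin_pos_of_below_floor {lo hi : ℝ} {W : Set ℝ} (h : KlTwinFloorBand lo hi W)
    {μ : ℝ} (hμ : μ ∈ W) (hB : klBottom0 .B1g μ < lo) : 0 < evenMargin μ := by
  have h2 : lo ≤ min (klBottom0 .A1g μ) (klBottom0 .B2g μ) :=
    le_min (h μ hμ).1.1 (h μ hμ).2.1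
  unfold evenMargin
  linarith

/-- K2 ⇒ K1 with the band's relative width: a certified band is already a (weak) twin statement. -/
theorem twinRivals_of_floorBand {lo hi : ℝ} {W : Set ℝ} (h : KlTwinFloorBand lo hi W)
    (hhi : hi < 0) {η : ℝ} (hη : hi - lo ≤ η * (-hi)) : KlTwinRivals η W := by
  intro μ hμ
  obtain ⟨⟨hA1, hA2⟩, ⟨hB1, hB2⟩⟩ := h μ hμ
  have hBneg : klBottom0 .B2g μ < 0 := lt_of_le_of_lt hB2 hhi
  rw [abs_of_neg hBneg]
  have hηnn : 0 ≤ η := by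
    by_contra hcon
    have : η * (-hi) < 0 := mul_neg_of_neg_of_pos (lt_of_not_ge hcon) (by linarith)
    linarith
  rw [abs_le]
  constructor <;> nlinarith

/-- The round-7 band instance implies the round-7 twin instance only with η = 6/13; the sharper
`KlTwinRivalsR7` (η = 1/5) is therefore a genuinely separate item. -/
theorem twinRivals_six_thirteenths_of_bandR7 (h : KlTwinFloorBandR7) :
    KlTwinRivals (6 / 13) twinWindow :=
  twinRivals_of_floorBand h (by norm_num) (by norm_num)

end Summit.HubbardSuperconductivity.HubbardSuperconductivity.Theorems.KlBoostTwins
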